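import Summits.NavierStokesRegularity.FunctionalMining.VorticityL6SaturatingLaw
import Summits.NavierStokesRegularity.FunctionalMining.SaturatingLawLyapunov
import HarnessLib

/-!
# Row `EK.E.q=6|T_M0`: the `Z₆` Lyapunov functional (kernel)

Search for candidate a priori estimates; no regularity claim. Cell `pub-nsfunc`, prove seat
(gen 10; referee F51.1). The K0 matrix books the saturating-Lyapunov rows `EK.*|T_M0`
(`M_F(κ) = K − (σ/κ) ν^{γ+1} F^{−1/σ}` antitone along every solution, `K = ½‖u‖₂²`) as inherited
from the corresponding saturating-law row `F|T_LD|G1`; the inheritance `T_LD ⟹ T_M0` is the tree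
lemma `SaturatingLaw.antitoneOn_lyapunov`. This file composes it with the tree law
`VorticityL6.vorticityL6_saturatingLaw` (`F = Z₆ = ∫|ω|⁶` on `T³`, `σ = 9`, `γ = 5/3`), so that
row `EK.E.q=6|T_M0` is a filed instance: `∃ κ > 0`, `K − (9/κ) ν^{8/3} Z₆^{−1/9}` antitone on
positive-`Z₆` windows (companion of `MomentLyapunov`, rows `EK.E.q=2,4`, `EK.EF.s=2`).

## Main statement

* `VorticityL6.lyapunov_antitoneOn` — row `EK.E.q=6|T_M0`.
-/

noncomputable section

open MeasureTheory Set

namespace Summit.NavierStokesRegularity.FunctionalMining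

open Literature.Analysis.FunctionSpaces Literature.Analysis.FluidPDE

/-- **Row `EK.E.q=6|T_M0` (kernel), on `T³ = UnitAddTorus (Fin 3)`.** There is `κ > 0` such that
along every zero-mean classical solution of unforced Navier–Stokes on `T³ × [a, b]` with
`Z₆(u t) = ∫|ω|⁶ > 0` on the window, `t ↦ K(u t) − (9/κ) ν^{8/3} Z₆(u t)^{−1/9}` is antitone on
`[a, b]` — from `VorticityL6.vorticityL6_saturatingLaw` (`σ = 9`, `γ = 5/3`; `κ` raised to
`max κ 1 > 0` by `SaturatingLaw.mono_kappa`) and `SaturatingLaw.antitoneOn_lyapunov`.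
Search for candidate a priori estimates; no regularity claim. [folklore] -/
theorem VorticityL6.lyapunov_antitoneOn :
    ∃ κ : ℝ, 0 < κ ∧ ∀ {ν a b : ℝ}, 0 < ν → a < b →
      ∀ {u : ℝ → UnitAddTorus (Fin 3) → EuclideanSpace ℝ (Fin 3)}
        {p : ℝ → UnitAddTorus (Fin 3) → ℝ},
        Torus.IsClassicalNSSolutionOn (Icc a b) ν 0 u p →
        (∀ t ∈ Icc a b, Torus.HasZeroMean (u t)) →
        (∀ t ∈ Icc a b, 0 < torusVorticityMoment 6 (u t)) →
        AntitoneOn (fun t => Torus.kineticEnergy (u t) -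
            9 / κ * ν ^ (8 / 3 : ℝ) * torusVorticityMoment 6 (u t) ^ (-(1 / 9 : ℝ))) (Icc a b) := by
  obtain ⟨κ₀, hκ₀⟩ := VorticityL6.vorticityL6_saturatingLaw
  have hF0 : ∀ v : UnitAddTorus (Fin 3) → EuclideanSpace ℝ (Fin 3), 0 ≤ torusVorticityMoment 6 v :=
    fun v => torusVorticityMoment_nonneg 6 v
  have hlaw : SaturatingLaw (d := Fin 3) (torusVorticityMoment 6) 9 (5 / 3) (max κ₀ 1) :=
    hκ₀.mono_kappa hF0 (le_max_left _ _)
  have hκ : 0 < max κ₀ 1 := lt_of_lt_of_le one_pos (le_max_right _ _)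
  refine ⟨max κ₀ 1, hκ, fun hν hab u p hsol hmean hpos => ?_⟩
  have h := hlaw.antitoneOn_lyapunov (by norm_num) hκ (by simp) hν hab hsol hmean hpos
  have hγ : (5 / 3 : ℝ) + 1 = 8 / 3 := by norm_num
  have hσ : -(9 : ℝ)⁻¹ = -(1 / 9 : ℝ) := by norm_num
  refine h.congr fun t _ => ?_
  simp only [hγ, hσ]

end Summit.NavierStokesRegularity.FunctionalMining
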